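import Literature.Computability.Complexity.FoldBricks
import Literature.Barriers.CriticalPhenomena.GridSAWCountingVerifier
import Literature.Barriers.CriticalPhenomena.GridSAWTowers
import HarnessLib

/-!
# Barrier `GridSAWCountingSharpPComplete`, tower step (T3, part B): the drawing checker —
# `IsGridDrawing` as a one-bit polynomial-time test on canonical codes

Sibling of `GridSAWCountingViaGridHamPath.lean` (the pivot `GRIDHAMPATHCOUNT`: `#HamPath` for
graphs of maximum degree three PRESENTED WITH a congestion-free grid drawing `(P, D, s, t)`; its
value is `0` unless `IsGridDrawing P D ∧ s < N ∧ t < N`), `GridSAWTowers.lean` / `GridSAWUniformDrawingCount.lean`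
((T1), (T2): the machine-free counting identity of the tower step) and `GridSAWCountingVerifier.lean`
(the `FP` tests `gridEdgeChk`, … on canonical codes). The parsimonious reduction
`LOT2003_thm7_fixedLength_towers : GRIDHAMPATHCOUNT ≤ᵖ_{parsimonious} SAWCOUNT₁` needs an `FP`
instance map, which must first DECIDE validity of the drawing in polynomial time ("validity is a
polynomial-time syntactic check", `GridSAWCountingViaGridHamPath`); this file provides that decision
procedure as an assembly of the tree's `FP` bricks, with its truth theorem:

* `lookupF ⟨code P, ⌜i⌝⟩ = code P[i]` (`binToUnaryFn` against the header as ruler, `nthItemFn`);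
* `edgeChk` on `⟨code P, code (i, j, π)⟩` — the eight clauses of `IsDrawnEdgeOf` (index bounds by
  `ltFn` against `lenBinF`, `i ≠ j`, first/last point `= P[i], P[j]`, `nodupFn`, `chainFn gridEdgeChk`,
  interior points by `allFn intChk`); `edgeChk_edgeArg_eq_true`;
* the pairwise clauses: `sameEndsChk`, `endsPairChk`, `cfPtChk`, `cfPairChk`, the double loop
  `allPairsFn` (`allPairsFn_eq_true`), and `pairwise_iff_nodup_and` (a pairwise clause for an
  irreflexive symmetric relation = no repetition + the test on all pairs of members);
* degrees: `incidentChk`, the saturating count `degStep`/`degChk` (`Brick.foldFn`, `FoldGrowth 1`;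
  `degChk_eq_true ↔ drawnDegree D v ≤ 3`) and the vertex loop `degAllChk` (`Brick.foldLoop` with the
  conjunction `andOp`; `degAllChk_eq_true ↔ ∀ v < N, drawnDegree D v ≤ 3`);
* **`drawingChk`**, `drawingChk_mem_FP`, `oneBit_drawingChk`, and
  **`drawingChk_drawingArg_eq_true : drawingChk ⟨code P, code D⟩ = [1] ↔ IsGridDrawing P D`**.

## References

* M. Liśkiewicz, M. Ogihara, S. Toda, *The complexity of counting self-avoiding walks in
  subgraphs of two-dimensional grids and hypercubes*, TCS 304 (2003) 129–156, §2.3, §4 (proof of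
  Theorem 7).
* S. Arora, B. Barak, *Computational Complexity: A Modern Approach*, CUP 2009, §1.3.
-/

noncomputable section

namespace Literature.Barriers.CriticalPhenomena.GridSAW

open _root_.Computability Literature.Computability.Complexity Literature.Computability.Complexity.Brick
  Literature.Computability.Complexity.HashBricks Literature.Computability.Complexity.CanonCode

/-! ### The codes of drawings, flat -/

/-- The code of a list of grid points (vertex images, or a realising path). [folklore] -/
theorem encode_pointList_eq (l : List GridPoint) :
    encodingGridPoint.listBool.encode l = boolPair (unaryEncodeNat l.length) (encList (l.map encodingGridPoint.encode)) :=
  listBool_encode_eq_encList _ l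

/-- The code of a drawn edge `(i, j, π)`. [folklore] -/
theorem encode_drawnEdge_eq (e : DrawnEdge) :
    encodingDrawnEdge.encode e = boolPair (encodeNat e.1) (boolPair (encodeNat e.2.1)
      (encodingGridPoint.listBool.encode e.2.2)) := rfl

/-- The code of a list of drawn edges. [folklore] -/
theorem encode_drawnEdgeList_eq (D : List DrawnEdge) :
    encodingDrawnEdge.listBool.encode D = boolPair (unaryEncodeNat D.length) (encList (D.map encodingDrawnEdge.encode)) :=
  listBool_encode_eq_encList _ D

/-! ### Looking up a vertex image by its binary index -/

/-- **`lookupF ⟨Pcode, i⟩`**: the code of `P[⟦i⟧]` — the index converted to unary against the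
header of `Pcode` as a ruler (`binToUnaryFn`), then `nthItemFn`. Junk (some item or `ε`) when
`⟦i⟧ ≥ |P|`. [folklore] -/
def lookupF : List Bool → List Bool :=
  nthItemFn ∘ fanoutFn (binToUnaryFn ∘ fanoutFn (fstF ∘ fstF) sndF) (sndF ∘ fstF)

/-- `lookupF ∈ FP`. [folklore] -/
theorem lookupF_mem_FP : lookupF ∈ FP :=
  comp_mem_FP nthItemFn_mem_FP (fanoutFn_mem_FP (comp_mem_FP binToUnaryFn_mem_FP
    (fanoutFn_mem_FP (comp_mem_FP fstF_mem_FP fstF_mem_FP) sndF_mem_FP)) (comp_mem_FP sndF_mem_FP fstF_mem_FP))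

/-- **Value of `lookupF`** in range. [folklore] -/
theorem lookupF_apply (P : List GridPoint) {i : ℕ} (hi : i < P.length) :
    lookupF (boolPair (encodingGridPoint.listBool.encode P) (encodeNat i)) = encodingGridPoint.encode (P[i]) := by
  simp only [lookupF, Function.comp_apply, fanoutFn_apply, encode_pointList_eq, fstF_boolPair, sndF_boolPair,
    binToUnaryFn_boolPair, bitsToNat_encodeNat, Literature.Computability.MetaComplexity.length_unaryEncodeNat, Nat.min_eq_left hi.le, nthItemFn_boolPair, List.length_replicate]
  rw [sndF_iterate_encList _ _ (by simp; omega), List.drop_eq_getElem_cons (by simpa using hi), List.getElem_map,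
    encList_cons, fstF_boolPair]

/-! ### The edge checker: `IsDrawnEdgeOf P (i, j, π)` on `⟨code P, code (i, j, π)⟩` -/

section EdgeChk

/-- Projections of the edge checker's argument `v = ⟨Pcode, ⟨i, ⟨j, πcode⟩⟩⟩`. [folklore] -/
def iF : List Bool → List Bool := fstF ∘ sndF
/-- See `iF`. [folklore] -/
def jF : List Bool → List Bool := fstF ∘ sndF ∘ sndF
/-- See `iF`. [folklore] -/
def piF : List Bool → List Bool := sndF ∘ sndF ∘ sndF
/-- The binary number of vertices. [folklore] -/
def NbinF : List Bool → List Bool := lenBinF ∘ fstF ∘ fstF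
/-- The code of `P[i]`. [folklore] -/
def PiF : List Bool → List Bool := lookupF ∘ fanoutFn fstF iF
/-- The code of `P[j]`. [folklore] -/
def PjF : List Bool → List Bool := lookupF ∘ fanoutFn fstF jF

/-- (k1) `i < N`. [folklore] -/
def k1F : List Bool → List Bool := ltFn ∘ fanoutFn iF NbinF
/-- (k2) `j < N`. [folklore] -/
def k2F : List Bool → List Bool := ltFn ∘ fanoutFn jF NbinF
/-- (k3) `i ≠ j`. [folklore] -/
def k3F : List Bool → List Bool := notFn (eqPairFn ∘ fanoutFn iF jF)
/-- (k4) `π ≠ []` and its first point is `P[i]`. [folklore] -/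
def k4F : List Bool → List Bool :=
  andFn (notFn (isNilFn ∘ fstF ∘ piF)) (eqPairFn ∘ fanoutFn (fstF ∘ sndF ∘ piF) PiF)
/-- (k5) the last point of `π` is `P[j]`. [folklore] -/
def k5F : List Bool → List Bool :=
  eqPairFn ∘ fanoutFn (nthItemFn ∘ fanoutFn (List.tail ∘ fstF ∘ piF) (sndF ∘ piF)) PjF
/-- (k6) `π` has no repeated point. [folklore] -/
def k6F : List Bool → List Bool := nodupFn ∘ fanoutFn (fun _ => []) (sndF ∘ piF)
/-- (k7) `π` is a chain of grid edges. [folklore] -/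
def k7F : List Bool → List Bool := chainFn (gridEdgeChk ∘ sndF) ∘ fanoutFn (fun _ => []) (sndF ∘ piF)
/-- The interior test on `⟨⟨Pitems, ⟨Pi, Pj⟩⟩, p⟩`: `p ∉ P ∨ p = P[i] ∨ p = P[j]`. [folklore] -/
def intChk : List Bool → List Bool :=
  orFn (notFn (anyFn eqPairFn ∘ fanoutFn sndF (fstF ∘ fstF)))
    (orFn (eqPairFn ∘ fanoutFn sndF (fstF ∘ sndF ∘ fstF)) (eqPairFn ∘ fanoutFn sndF (sndF ∘ sndF ∘ fstF)))
/-- (k8) every point of `π` that is a vertex image is `P[i]` or `P[j]`. [folklore] -/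
def k8F : List Bool → List Bool :=
  allFn intChk ∘ fanoutFn (fanoutFn (sndF ∘ fstF) (fanoutFn PiF PjF)) (sndF ∘ piF)

/-- **The edge checker.** [cite: LiskiewiczOgiharaToda2003, §4 (proof of Theorem 7: edges realised by vertex-disjoint grid paths)] -/
def edgeChk : List Bool → List Bool :=
  andFn k1F (andFn k2F (andFn k3F (andFn k4F (andFn k5F (andFn k6F (andFn k7F k8F))))))

/-- The eight parts are one-bit. [folklore] -/
theorem oneBit_edgeChk_parts : OneBit k1F ∧ OneBit k2F ∧ OneBit k3F ∧ OneBit k4F ∧ OneBit k5F ∧ OneBit k6F ∧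
    OneBit k7F ∧ OneBit k8F :=
  ⟨oneBit_ltFn.comp _, oneBit_ltFn.comp _, oneBit_notFn (oneBit_eqPairFn.comp _),
    oneBit_andFn (oneBit_notFn (oneBit_isNilFn.comp _)) (oneBit_eqPairFn.comp _), oneBit_eqPairFn.comp _,
    oneBit_nodupFn.comp _, (oneBit_chainFn _).comp _,
    (oneBit_allFn (oneBit_orFn (oneBit_notFn ((oneBit_anyFn oneBit_eqPairFn).comp _))
      (oneBit_orFn (oneBit_eqPairFn.comp _) (oneBit_eqPairFn.comp _)))).comp _⟩

/-- `edgeChk` is one-bit. [folklore] -/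
theorem oneBit_edgeChk : OneBit edgeChk := by
  obtain ⟨h1, h2, h3, h4, h5, h6, h7, h8⟩ := oneBit_edgeChk_parts
  exact oneBit_andFn h1 (oneBit_andFn h2 (oneBit_andFn h3 (oneBit_andFn h4 (oneBit_andFn h5 (oneBit_andFn h6
    (oneBit_andFn h7 h8))))))

/-- Membership in `FP` of the projections. [folklore] -/
theorem proj_mem_FP : iF ∈ FP ∧ jF ∈ FP ∧ piF ∈ FP ∧ NbinF ∈ FP ∧ PiF ∈ FP ∧ PjF ∈ FP := by
  have hi : iF ∈ FP := comp_mem_FP fstF_mem_FP sndF_mem_FP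
  have hj : jF ∈ FP := comp_mem_FP fstF_mem_FP (comp_mem_FP sndF_mem_FP sndF_mem_FP)
  exact ⟨hi, hj, comp_mem_FP sndF_mem_FP (comp_mem_FP sndF_mem_FP sndF_mem_FP),
    comp_mem_FP lenBinF_mem_FP (comp_mem_FP fstF_mem_FP fstF_mem_FP),
    comp_mem_FP lookupF_mem_FP (fanoutFn_mem_FP fstF_mem_FP hi), comp_mem_FP lookupF_mem_FP (fanoutFn_mem_FP fstF_mem_FP hj)⟩

/-- `intChk ∈ FP`. [folklore] -/
theorem intChk_mem_FP : intChk ∈ FP :=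
  orFn_mem_FP (notFn_mem_FP (comp_mem_FP (anyFn_mem_FP eqPairFn_mem_FP oneBit_eqPairFn)
    (fanoutFn_mem_FP sndF_mem_FP (comp_mem_FP fstF_mem_FP fstF_mem_FP))))
    (orFn_mem_FP (comp_mem_FP eqPairFn_mem_FP (fanoutFn_mem_FP sndF_mem_FP (comp_mem_FP fstF_mem_FP
      (comp_mem_FP sndF_mem_FP fstF_mem_FP))))
      (comp_mem_FP eqPairFn_mem_FP (fanoutFn_mem_FP sndF_mem_FP (comp_mem_FP sndF_mem_FP (comp_mem_FP sndF_mem_FP fstF_mem_FP)))))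

/-- **`edgeChk ∈ FP`.** [folklore] -/
theorem edgeChk_mem_FP : edgeChk ∈ FP := by
  obtain ⟨hi, hj, hpi, hN, hPi, hPj⟩ := proj_mem_FP
  refine andFn_mem_FP (comp_mem_FP ltFn_mem_FP (fanoutFn_mem_FP hi hN)) (andFn_mem_FP (comp_mem_FP ltFn_mem_FP
    (fanoutFn_mem_FP hj hN)) (andFn_mem_FP (notFn_mem_FP (comp_mem_FP eqPairFn_mem_FP (fanoutFn_mem_FP hi hj)))
    (andFn_mem_FP ?_ (andFn_mem_FP ?_ (andFn_mem_FP ?_ (andFn_mem_FP ?_ ?_))))))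
  · exact andFn_mem_FP (notFn_mem_FP (comp_mem_FP isNilFn_mem_FP (comp_mem_FP fstF_mem_FP hpi)))
      (comp_mem_FP eqPairFn_mem_FP (fanoutFn_mem_FP (comp_mem_FP fstF_mem_FP (comp_mem_FP sndF_mem_FP hpi)) hPi))
  · exact comp_mem_FP eqPairFn_mem_FP (fanoutFn_mem_FP (comp_mem_FP nthItemFn_mem_FP (fanoutFn_mem_FP
      (comp_mem_FP PRelSigma.tail_mem_FP (comp_mem_FP fstF_mem_FP hpi)) (comp_mem_FP sndF_mem_FP hpi))) hPj)
  · exact comp_mem_FP nodupFn_mem_FP (fanoutFn_mem_FP (const_mem_FP _) (comp_mem_FP sndF_mem_FP hpi))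
  · exact comp_mem_FP (chainFn_mem_FP (comp_mem_FP gridEdgeChk_mem_FP sndF_mem_FP) (oneBit_gridEdgeChk.comp _))
      (fanoutFn_mem_FP (const_mem_FP _) (comp_mem_FP sndF_mem_FP hpi))
  · exact comp_mem_FP (allFn_mem_FP intChk_mem_FP (oneBit_orFn (oneBit_notFn ((oneBit_anyFn oneBit_eqPairFn).comp _))
      (oneBit_orFn (oneBit_eqPairFn.comp _) (oneBit_eqPairFn.comp _))))
      (fanoutFn_mem_FP (fanoutFn_mem_FP (comp_mem_FP sndF_mem_FP fstF_mem_FP) (fanoutFn_mem_FP hPi hPj))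
        (comp_mem_FP sndF_mem_FP hpi))

/-! #### Truth of the edge checker -/

variable (P : List GridPoint) (e : DrawnEdge)

/-- The canonical argument of the edge checker. [folklore] -/
def edgeArg : List Bool := boolPair (encodingGridPoint.listBool.encode P) (encodingDrawnEdge.encode e)

/-- Values of the projections on the canonical argument. [folklore] -/
theorem proj_edgeArg :
    iF (edgeArg P e) = encodeNat e.1 ∧ jF (edgeArg P e) = encodeNat e.2.1 ∧
    piF (edgeArg P e) = encodingGridPoint.listBool.encode e.2.2 ∧ NbinF (edgeArg P e) = encodeNat P.length ∧
    fstF (edgeArg P e) = encodingGridPoint.listBool.encode P := by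
  simp [iF, jF, piF, NbinF, edgeArg, encode_drawnEdge_eq, encode_pointList_eq, Literature.Computability.MetaComplexity.length_unaryEncodeNat]

/-- (k1) and (k2) are the index bounds. [folklore] -/
theorem k12_edgeArg : (k1F (edgeArg P e) = [true] ↔ e.1 < P.length) ∧ (k2F (edgeArg P e) = [true] ↔ e.2.1 < P.length) := by
  obtain ⟨hi, hj, -, hN, -⟩ := proj_edgeArg P e
  simp only [k1F, k2F, Function.comp_apply, fanoutFn_apply, hi, hj, hN, ltFn_boolPair, bitsToNat_encodeNat]
  constructor <;> simp

/-- (k3) is `i ≠ j`. [folklore] -/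
theorem k3_edgeArg : k3F (edgeArg P e) = [true] ↔ e.1 ≠ e.2.1 := by
  obtain ⟨hi, hj, -⟩ := proj_edgeArg P e
  rw [k3F, notFn_eq_true_iff (oneBit_eqPairFn.comp _)]
  simp only [Function.comp_apply, fanoutFn_apply, hi, hj, eqPairFn_boolPair_eq_true, encodeNat_inj, ne_eq]

/-- In range, `PiF`/`PjF` are the codes of `P[i]`, `P[j]`. [folklore] -/
theorem PiF_edgeArg (hi : e.1 < P.length) : PiF (edgeArg P e) = encodingGridPoint.encode (P[e.1]) := by
  obtain ⟨hi', -, -, -, hf⟩ := proj_edgeArg P e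
  rw [PiF, Function.comp_apply, fanoutFn_apply, hf, hi', lookupF_apply P hi]

/-- See `PiF_edgeArg`. [folklore] -/
theorem PjF_edgeArg (hj : e.2.1 < P.length) : PjF (edgeArg P e) = encodingGridPoint.encode (P[e.2.1]) := by
  obtain ⟨-, hj', -, -, hf⟩ := proj_edgeArg P e
  rw [PjF, Function.comp_apply, fanoutFn_apply, hf, hj', lookupF_apply P hj]

/-- (k4) is "`π.head? = P[i]?`" (in range). [folklore] -/
theorem k4_edgeArg (hi : e.1 < P.length) : k4F (edgeArg P e) = [true] ↔ e.2.2.head? = P[e.1]? := by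
  obtain ⟨-, -, hpi, -, -⟩ := proj_edgeArg P e
  rw [k4F, andFn_eq_true_iff (oneBit_notFn (oneBit_isNilFn.comp _)) (oneBit_eqPairFn.comp _),
    notFn_eq_true_iff (oneBit_isNilFn.comp _)]
  simp only [Function.comp_apply, fanoutFn_apply, hpi, PiF_edgeArg P e hi, encode_pointList_eq, fstF_boolPair,
    sndF_boolPair, isNilFn_eq_true_iff, eqPairFn_boolPair_eq_true, List.getElem?_eq_getElem hi]
  cases h : e.2.2 with
  | nil => simp [unaryEncodeNat]
  | cons p l =>
    simp only [List.length_cons, List.map_cons, encList_cons, fstF_boolPair, List.head?_cons, Option.some.injEq,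
      (encodingGridPoint.encode_injective).eq_iff, and_iff_right_iff_imp]
    intro _; simp [unaryEncodeNat]

/-- (k5) is "`π.getLast? = P[j]?`" (in range). [folklore] -/
theorem k5_edgeArg (hj : e.2.1 < P.length) : k5F (edgeArg P e) = [true] ↔ e.2.2.getLast? = P[e.2.1]? := by
  obtain ⟨-, -, hpi, -, -⟩ := proj_edgeArg P e
  simp only [k5F, Function.comp_apply, fanoutFn_apply, hpi, PjF_edgeArg P e hj, encode_pointList_eq, fstF_boolPair,
    sndF_boolPair, eqPairFn_boolPair_eq_true, nthItemFn_boolPair, List.length_tail, Literature.Computability.MetaComplexity.length_unaryEncodeNat, List.getElem?_eq_getElem hj]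
  rw [sndF_iterate_encList _ _ (by simp)]
  cases (e.2.2).eq_nil_or_concat with
  | inl h => rw [h]; simp [fstF, boolUnpair, encode_point_eq, boolPair]
  | inr h =>
    obtain ⟨l, p, hlp⟩ := h
    rw [hlp, List.concat_eq_append, List.map_append, List.length_append, List.length_singleton, Nat.add_sub_cancel,
      List.drop_append_of_le_length (by simp), List.drop_eq_nil_of_le (by simp), List.nil_append,
      List.map_singleton, encList_cons, fstF_boolPair, List.getLast?_append, List.getLast?_singleton]
    simp only [Option.some_or, Option.some.injEq, (encodingGridPoint.encode_injective).eq_iff]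

/-- (k6) is `π.Nodup`. [folklore] -/
theorem k6_edgeArg : k6F (edgeArg P e) = [true] ↔ e.2.2.Nodup := by
  obtain ⟨-, -, hpi, -, -⟩ := proj_edgeArg P e
  simp only [k6F, Function.comp_apply, fanoutFn_apply, hpi, encode_pointList_eq, sndF_boolPair, nodupFn_encList_eq_true]
  exact List.nodup_map_iff encodingGridPoint.encode_injective

/-- (k7) is `IsChain IsGridEdge π`. [folklore] -/
theorem k7_edgeArg : k7F (edgeArg P e) = [true] ↔ List.IsChain IsGridEdge e.2.2 := by
  obtain ⟨-, -, hpi, -, -⟩ := proj_edgeArg P e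
  simp only [k7F, Function.comp_apply, fanoutFn_apply, hpi, encode_pointList_eq, sndF_boolPair,
    chainFn_encList_eq_true (oneBit_gridEdgeChk.comp _), List.isChain_map]
  refine List.IsChain.iff fun p q => ?_
  simp only [gridEdgeChk_eq_true]

/-- `intChk` is one-bit. [folklore] -/
theorem oneBit_intChk : OneBit intChk :=
  oneBit_orFn (oneBit_notFn ((oneBit_anyFn oneBit_eqPairFn).comp _)) (oneBit_orFn (oneBit_eqPairFn.comp _)
    (oneBit_eqPairFn.comp _))

/-- Truth of the interior test on canonical arguments. [folklore] -/
theorem intChk_eq_true (a b p : GridPoint) :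
    intChk (boolPair (boolPair (encList (P.map encodingGridPoint.encode)) (boolPair (encodingGridPoint.encode a)
      (encodingGridPoint.encode b))) (encodingGridPoint.encode p)) = [true] ↔ (p ∉ P ∨ p = a ∨ p = b) := by
  rw [intChk, orFn_eq_true_iff (oneBit_notFn ((oneBit_anyFn oneBit_eqPairFn).comp _)) (oneBit_orFn (oneBit_eqPairFn.comp _)
    (oneBit_eqPairFn.comp _)), notFn_eq_true_iff ((oneBit_anyFn oneBit_eqPairFn).comp _),
    orFn_eq_true_iff (oneBit_eqPairFn.comp _) (oneBit_eqPairFn.comp _)]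
  simp only [Function.comp_apply, fanoutFn_apply, fstF_boolPair, sndF_boolPair, eqPairFn_boolPair_eq_true,
    (encodingGridPoint.encode_injective).eq_iff, anyFn_boolPair_eq_true oneBit_eqPairFn, decNil_encList]
  have hmem : (∃ x ∈ P.map encodingGridPoint.encode, encodingGridPoint.encode p = x) ↔ p ∈ P := by
    constructor
    · rintro ⟨x, hx, hpx⟩; obtain ⟨q, hq, rfl⟩ := List.mem_map.1 hx
      rwa [encodingGridPoint.encode_injective hpx]
    · intro h; exact ⟨_, List.mem_map.2 ⟨p, h, rfl⟩, rfl⟩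
  rw [hmem]

/-- (k8) is the interior clause (in range). [folklore] -/
theorem k8_edgeArg (hi : e.1 < P.length) (hj : e.2.1 < P.length) :
    k8F (edgeArg P e) = [true] ↔ ∀ p ∈ e.2.2, p ∈ P → (P[e.1]? = some p ∨ P[e.2.1]? = some p) := by
  obtain ⟨-, -, hpi, -, hf⟩ := proj_edgeArg P e
  simp only [k8F, Function.comp_apply, fanoutFn_apply, hpi, hf, PiF_edgeArg P e hi, PjF_edgeArg P e hj,
    encode_pointList_eq, sndF_boolPair, allFn_boolPair_eq_true oneBit_intChk, decNil_encList, List.forall_mem_map,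
    intChk_eq_true, List.getElem?_eq_getElem hi, List.getElem?_eq_getElem hj, Option.some.injEq]
  refine forall₂_congr fun p _ => ?_
  constructor
  · rintro (h | rfl | rfl) hp
    · exact absurd hp h
    · exact Or.inl rfl
    · exact Or.inr rfl
  · intro h
    by_cases hp : p ∈ P
    · rcases h hp with h | h
      · exact Or.inr (Or.inl h.symm)
      · exact Or.inr (Or.inr h.symm)
    · exact Or.inl hp

/-- **Truth of the edge checker.** [cite: LiskiewiczOgiharaToda2003, §4 (proof of Theorem 7)] -/
theorem edgeChk_edgeArg_eq_true : edgeChk (edgeArg P e) = [true] ↔ IsDrawnEdgeOf P e := by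
  obtain ⟨h1, h2, h3, h4, h5, h6, h7, h8⟩ := oneBit_edgeChk_parts
  rw [edgeChk, andFn_eq_true_iff h1 (oneBit_andFn h2 (oneBit_andFn h3 (oneBit_andFn h4 (oneBit_andFn h5 (oneBit_andFn h6
      (oneBit_andFn h7 h8)))))), andFn_eq_true_iff h2 (oneBit_andFn h3 (oneBit_andFn h4 (oneBit_andFn h5 (oneBit_andFn h6
      (oneBit_andFn h7 h8))))), andFn_eq_true_iff h3 (oneBit_andFn h4 (oneBit_andFn h5 (oneBit_andFn h6 (oneBit_andFn h7 h8)))),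
    andFn_eq_true_iff h4 (oneBit_andFn h5 (oneBit_andFn h6 (oneBit_andFn h7 h8))), andFn_eq_true_iff h5 (oneBit_andFn h6
      (oneBit_andFn h7 h8)), andFn_eq_true_iff h6 (oneBit_andFn h7 h8), andFn_eq_true_iff h7 h8,
    (k12_edgeArg P e).1, (k12_edgeArg P e).2, k3_edgeArg, k6_edgeArg, k7_edgeArg]
  unfold IsDrawnEdgeOf
  constructor
  · rintro ⟨hi, hj, hne, hk4, hk5, hnd, hch, hk8⟩
    exact ⟨hi, hj, hne, (k4_edgeArg P e hi).1 hk4, (k5_edgeArg P e hj).1 hk5, hnd, hch, (k8_edgeArg P e hi hj).1 hk8⟩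
  · rintro ⟨hi, hj, hne, hhead, hlast, hnd, hch, hint⟩
    exact ⟨hi, hj, hne, (k4_edgeArg P e hi).2 hhead, (k5_edgeArg P e hj).2 hlast, hnd, hch, (k8_edgeArg P e hi hj).2 hint⟩

end EdgeChk

/-! ### Pairwise clauses: different ends and congestion-freeness -/

section PairChk

/-- On `⟨e, e'⟩` (codes of drawn edges): `SameEnds e e'`. [folklore] -/
def sameEndsChk : List Bool → List Bool :=
  orFn (andFn (eqPairFn ∘ fanoutFn (fstF ∘ fstF) (fstF ∘ sndF)) (eqPairFn ∘ fanoutFn (fstF ∘ sndF ∘ fstF) (fstF ∘ sndF ∘ sndF)))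
    (andFn (eqPairFn ∘ fanoutFn (fstF ∘ fstF) (fstF ∘ sndF ∘ sndF)) (eqPairFn ∘ fanoutFn (fstF ∘ sndF ∘ fstF) (fstF ∘ sndF)))

/-- `sameEndsChk` is one-bit. [folklore] -/
theorem oneBit_sameEndsChk : OneBit sameEndsChk :=
  oneBit_orFn (oneBit_andFn (oneBit_eqPairFn.comp _) (oneBit_eqPairFn.comp _))
    (oneBit_andFn (oneBit_eqPairFn.comp _) (oneBit_eqPairFn.comp _))

/-- `sameEndsChk ∈ FP`. [folklore] -/
theorem sameEndsChk_mem_FP : sameEndsChk ∈ FP :=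
  orFn_mem_FP
    (andFn_mem_FP (comp_mem_FP eqPairFn_mem_FP (fanoutFn_mem_FP (comp_mem_FP fstF_mem_FP fstF_mem_FP)
      (comp_mem_FP fstF_mem_FP sndF_mem_FP)))
      (comp_mem_FP eqPairFn_mem_FP (fanoutFn_mem_FP (comp_mem_FP fstF_mem_FP (comp_mem_FP sndF_mem_FP fstF_mem_FP))
        (comp_mem_FP fstF_mem_FP (comp_mem_FP sndF_mem_FP sndF_mem_FP)))))
    (andFn_mem_FP (comp_mem_FP eqPairFn_mem_FP (fanoutFn_mem_FP (comp_mem_FP fstF_mem_FP fstF_mem_FP)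
      (comp_mem_FP fstF_mem_FP (comp_mem_FP sndF_mem_FP sndF_mem_FP))))
      (comp_mem_FP eqPairFn_mem_FP (fanoutFn_mem_FP (comp_mem_FP fstF_mem_FP (comp_mem_FP sndF_mem_FP fstF_mem_FP))
        (comp_mem_FP fstF_mem_FP sndF_mem_FP))))

/-- Truth of `sameEndsChk`. [folklore] -/
theorem sameEndsChk_eq_true (e e' : DrawnEdge) :
    sameEndsChk (boolPair (encodingDrawnEdge.encode e) (encodingDrawnEdge.encode e')) = [true] ↔ SameEnds e e' := by
  rw [sameEndsChk, orFn_eq_true_iff (oneBit_andFn (oneBit_eqPairFn.comp _) (oneBit_eqPairFn.comp _))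
    (oneBit_andFn (oneBit_eqPairFn.comp _) (oneBit_eqPairFn.comp _)), andFn_eq_true_iff (oneBit_eqPairFn.comp _)
    (oneBit_eqPairFn.comp _), andFn_eq_true_iff (oneBit_eqPairFn.comp _) (oneBit_eqPairFn.comp _)]
  simp only [Function.comp_apply, fanoutFn_apply, encode_drawnEdge_eq, fstF_boolPair, sndF_boolPair,
    eqPairFn_boolPair_eq_true, encodeNat_inj, SameEnds]

/-- The pair test of the ends clause on `⟨e, e'⟩`: `e = e' ∨ ¬ SameEnds e e'`. [folklore] -/
def endsPairChk : List Bool → List Bool := orFn eqPairFn (notFn sameEndsChk)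

/-- `endsPairChk` is one-bit and in `FP`. [folklore] -/
theorem oneBit_endsPairChk : OneBit endsPairChk := oneBit_orFn oneBit_eqPairFn (oneBit_notFn oneBit_sameEndsChk)

/-- See `oneBit_endsPairChk`. [folklore] -/
theorem endsPairChk_mem_FP : endsPairChk ∈ FP := orFn_mem_FP eqPairFn_mem_FP (notFn_mem_FP sameEndsChk_mem_FP)

/-- Truth of `endsPairChk`. [folklore] -/
theorem endsPairChk_eq_true (e e' : DrawnEdge) :
    endsPairChk (boolPair (encodingDrawnEdge.encode e) (encodingDrawnEdge.encode e')) = [true] ↔ (e = e' ∨ ¬ SameEnds e e') := by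
  rw [endsPairChk, orFn_eq_true_iff oneBit_eqPairFn (oneBit_notFn oneBit_sameEndsChk), notFn_eq_true_iff oneBit_sameEndsChk,
    eqPairFn_boolPair_eq_true, (encodingDrawnEdge.encode_injective).eq_iff, sameEndsChk_eq_true]

/-- The point test of the congestion clause on `⟨⟨Pitems, π'items⟩, p⟩`: `p ∉ π' ∨ p ∈ P`.
[folklore] -/
def cfPtChk : List Bool → List Bool :=
  orFn (notFn (anyFn eqPairFn ∘ fanoutFn sndF (sndF ∘ fstF))) (anyFn eqPairFn ∘ fanoutFn sndF (fstF ∘ fstF))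

/-- `cfPtChk` is one-bit. [folklore] -/
theorem oneBit_cfPtChk : OneBit cfPtChk :=
  oneBit_orFn (oneBit_notFn ((oneBit_anyFn oneBit_eqPairFn).comp _)) ((oneBit_anyFn oneBit_eqPairFn).comp _)

/-- `cfPtChk ∈ FP`. [folklore] -/
theorem cfPtChk_mem_FP : cfPtChk ∈ FP :=
  orFn_mem_FP (notFn_mem_FP (comp_mem_FP (anyFn_mem_FP eqPairFn_mem_FP oneBit_eqPairFn)
    (fanoutFn_mem_FP sndF_mem_FP (comp_mem_FP sndF_mem_FP fstF_mem_FP))))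
    (comp_mem_FP (anyFn_mem_FP eqPairFn_mem_FP oneBit_eqPairFn) (fanoutFn_mem_FP sndF_mem_FP (comp_mem_FP fstF_mem_FP fstF_mem_FP)))

/-- Membership among point codes is membership. [folklore] -/
theorem exists_mem_map_encode_iff (l : List GridPoint) (p : GridPoint) :
    (∃ x ∈ l.map encodingGridPoint.encode, eqPairFn (boolPair (encodingGridPoint.encode p) x) = [true]) ↔ p ∈ l := by
  simp only [eqPairFn_boolPair_eq_true]
  constructor
  · rintro ⟨x, hx, hpx⟩; obtain ⟨q, hq, rfl⟩ := List.mem_map.1 hx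
    rwa [encodingGridPoint.encode_injective hpx]
  · intro h; exact ⟨_, List.mem_map.2 ⟨p, h, rfl⟩, rfl⟩

/-- Truth of `cfPtChk`. [folklore] -/
theorem cfPtChk_eq_true (P π' : List GridPoint) (p : GridPoint) :
    cfPtChk (boolPair (boolPair (encList (P.map encodingGridPoint.encode)) (encList (π'.map encodingGridPoint.encode)))
      (encodingGridPoint.encode p)) = [true] ↔ (p ∉ π' ∨ p ∈ P) := by
  rw [cfPtChk, orFn_eq_true_iff (oneBit_notFn ((oneBit_anyFn oneBit_eqPairFn).comp _)) ((oneBit_anyFn oneBit_eqPairFn).comp _),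
    notFn_eq_true_iff ((oneBit_anyFn oneBit_eqPairFn).comp _)]
  simp only [Function.comp_apply, fanoutFn_apply, fstF_boolPair, sndF_boolPair, anyFn_boolPair_eq_true oneBit_eqPairFn,
    decNil_encList, exists_mem_map_encode_iff]

/-- The pair test of the congestion clause on `⟨⟨Pitems, e⟩, e'⟩`:
`e = e' ∨ ∀ p ∈ π, p ∉ π' ∨ p ∈ P`. [folklore] -/
def cfPairChk : List Bool → List Bool :=
  orFn (eqPairFn ∘ fanoutFn (sndF ∘ fstF) sndF)
    (allFn cfPtChk ∘ fanoutFn (fanoutFn (fstF ∘ fstF) (sndF ∘ sndF ∘ sndF ∘ sndF)) (sndF ∘ sndF ∘ sndF ∘ sndF ∘ fstF))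

/-- `cfPairChk` is one-bit. [folklore] -/
theorem oneBit_cfPairChk : OneBit cfPairChk := oneBit_orFn (oneBit_eqPairFn.comp _) ((oneBit_allFn oneBit_cfPtChk).comp _)

/-- `cfPairChk ∈ FP`. [folklore] -/
theorem cfPairChk_mem_FP : cfPairChk ∈ FP :=
  orFn_mem_FP (comp_mem_FP eqPairFn_mem_FP (fanoutFn_mem_FP (comp_mem_FP sndF_mem_FP fstF_mem_FP) sndF_mem_FP))
    (comp_mem_FP (allFn_mem_FP cfPtChk_mem_FP oneBit_cfPtChk) (fanoutFn_mem_FP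
      (fanoutFn_mem_FP (comp_mem_FP fstF_mem_FP fstF_mem_FP) (comp_mem_FP sndF_mem_FP (comp_mem_FP sndF_mem_FP
        (comp_mem_FP sndF_mem_FP sndF_mem_FP))))
      (comp_mem_FP sndF_mem_FP (comp_mem_FP sndF_mem_FP (comp_mem_FP sndF_mem_FP (comp_mem_FP sndF_mem_FP fstF_mem_FP))))))

/-- Truth of `cfPairChk`. [folklore] -/
theorem cfPairChk_eq_true (P : List GridPoint) (e e' : DrawnEdge) :
    cfPairChk (boolPair (boolPair (encList (P.map encodingGridPoint.encode)) (encodingDrawnEdge.encode e))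
      (encodingDrawnEdge.encode e')) = [true] ↔ (e = e' ∨ ∀ p ∈ e.2.2, p ∈ e'.2.2 → p ∈ P) := by
  rw [cfPairChk, orFn_eq_true_iff (oneBit_eqPairFn.comp _) ((oneBit_allFn oneBit_cfPtChk).comp _)]
  simp only [Function.comp_apply, fanoutFn_apply, fstF_boolPair, sndF_boolPair, eqPairFn_boolPair_eq_true,
    (encodingDrawnEdge.encode_injective).eq_iff]
  simp only [encode_drawnEdge_eq, encode_pointList_eq, sndF_boolPair,
    allFn_boolPair_eq_true oneBit_cfPtChk, decNil_encList, List.forall_mem_map, cfPtChk_eq_true]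
  refine or_congr Iff.rfl (forall₂_congr fun p _ => ?_)
  tauto

/-- The double loop of a pair test `c` over the items `L` of a list code, with context `x`:
`∀ a ∈ L, ∀ b ∈ L, c ⟨⟨x, a⟩, b⟩ = [1]`, on `⟨x, L⟩`. [folklore] -/
def allPairsFn (c : List Bool → List Bool) : List Bool → List Bool :=
  allFn (allFn c ∘ fanoutFn (fanoutFn (fstF ∘ fstF) sndF) (sndF ∘ fstF)) ∘ fanoutFn (fanoutFn fstF sndF) sndF

/-- `allPairsFn c` is one-bit. [folklore] -/
theorem oneBit_allPairsFn (c : List Bool → List Bool) (hc : OneBit c) : OneBit (allPairsFn c) :=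
  (oneBit_allFn ((oneBit_allFn hc).comp _)).comp _

/-- `allPairsFn c ∈ FP`. [folklore] -/
theorem allPairsFn_mem_FP {c : List Bool → List Bool} (hFP : c ∈ FP) (hc : OneBit c) : allPairsFn c ∈ FP :=
  comp_mem_FP (allFn_mem_FP (comp_mem_FP (allFn_mem_FP hFP hc) (fanoutFn_mem_FP (fanoutFn_mem_FP
    (comp_mem_FP fstF_mem_FP fstF_mem_FP) sndF_mem_FP) (comp_mem_FP sndF_mem_FP fstF_mem_FP))) ((oneBit_allFn hc).comp _))
    (fanoutFn_mem_FP (fanoutFn_mem_FP fstF_mem_FP sndF_mem_FP) sndF_mem_FP)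

/-- **Truth of the double loop.** [folklore] -/
theorem allPairsFn_eq_true {c : List Bool → List Bool} (hc : OneBit c) (x : List Bool) (l : List (List Bool)) :
    allPairsFn c (boolPair x (encList l)) = [true] ↔ ∀ a ∈ l, ∀ b ∈ l, c (boolPair (boolPair x a) b) = [true] := by
  simp only [allPairsFn, Function.comp_apply, fanoutFn_apply, fstF_boolPair, sndF_boolPair,
    allFn_boolPair_eq_true ((oneBit_allFn hc).comp _), decNil_encList, allFn_boolPair_eq_true hc]

/-- **A pairwise clause as nodup plus a test on all pairs of members**: for a relation failing
on equal arguments and symmetric, `Pairwise R l ↔ l.Nodup ∧ ∀ a b ∈ l, a = b ∨ R a b`. [folklore] -/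
theorem pairwise_iff_nodup_and {α : Type*} {R : α → α → Prop} (hirr : ∀ a, ¬ R a a) (hsymm : ∀ a b, R a b → R b a)
    (l : List α) : l.Pairwise R ↔ l.Nodup ∧ ∀ a ∈ l, ∀ b ∈ l, a = b ∨ R a b := by
  constructor
  · intro h
    have hnd : l.Nodup := List.Pairwise.imp (S := fun a b => a ≠ b) (fun {a b} hab heq => by subst heq; exact hirr _ hab) h
    exact ⟨hnd, fun a ha b hb => by
      by_cases hab : a = b
      · exact Or.inl hab
      · rcases pairwise_mem_mem h ha hb hab with h | h
        · exact Or.inr h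
        · exact Or.inr (hsymm _ _ h)⟩
  · rintro ⟨hnd, h⟩
    exact hnd.imp_of_mem fun ha hb hab => (h _ ha _ hb).resolve_left hab

end PairChk

/-! ### Degrees: a saturating count over the edges, for every vertex -/

section Degrees

/-- On `⟨vbin, e⟩`: the edge `e` is incident with the vertex of binary index `vbin`. [folklore] -/
def incidentChk : List Bool → List Bool :=
  orFn (eqPairFn ∘ fanoutFn (fstF ∘ sndF) fstF) (eqPairFn ∘ fanoutFn (fstF ∘ sndF ∘ sndF) fstF)

/-- `incidentChk` is one-bit and in `FP`. [folklore] -/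
theorem oneBit_incidentChk : OneBit incidentChk := oneBit_orFn (oneBit_eqPairFn.comp _) (oneBit_eqPairFn.comp _)

/-- See `oneBit_incidentChk`. [folklore] -/
theorem incidentChk_mem_FP : incidentChk ∈ FP :=
  orFn_mem_FP (comp_mem_FP eqPairFn_mem_FP (fanoutFn_mem_FP (comp_mem_FP fstF_mem_FP sndF_mem_FP) fstF_mem_FP))
    (comp_mem_FP eqPairFn_mem_FP (fanoutFn_mem_FP (comp_mem_FP fstF_mem_FP (comp_mem_FP sndF_mem_FP sndF_mem_FP)) fstF_mem_FP))

/-- Truth of `incidentChk`. [folklore] -/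
theorem incidentChk_eq_true (v : ℕ) (e : DrawnEdge) :
    incidentChk (boolPair (encodeNat v) (encodingDrawnEdge.encode e)) = [true] ↔ (e.1 = v ∨ e.2.1 = v) := by
  rw [incidentChk, orFn_eq_true_iff (oneBit_eqPairFn.comp _) (oneBit_eqPairFn.comp _)]
  simp only [Function.comp_apply, fanoutFn_apply, encode_drawnEdge_eq, fstF_boolPair, sndF_boolPair,
    eqPairFn_boolPair_eq_true, encodeNat_inj]

/-- The step of the degree fold on `⟨⟨vbin, L⟩, ⟨e, acc⟩⟩`: the unary accumulator gains a `1`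
when `e` is incident with the vertex and it has fewer than four `1`s (a count saturating at `4`).
[folklore] -/
def degStep : List Bool → List Bool :=
  iteFn (andFn (incidentChk ∘ fanoutFn (fstF ∘ fstF) (fstF ∘ sndF)) (ltLenF ∘ fanoutFn (sndF ∘ sndF) fun _ => ones 4))
    (List.cons true ∘ sndF ∘ sndF) (sndF ∘ sndF)

/-- `degStep ∈ FP`. [folklore] -/
theorem degStep_mem_FP : degStep ∈ FP :=
  iteFn_mem_FP (andFn_mem_FP (comp_mem_FP incidentChk_mem_FP (fanoutFn_mem_FP (comp_mem_FP fstF_mem_FP fstF_mem_FP)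
    (comp_mem_FP fstF_mem_FP sndF_mem_FP))) (comp_mem_FP ltLenF_mem_FP (fanoutFn_mem_FP (comp_mem_FP sndF_mem_FP sndF_mem_FP)
    (const_mem_FP _)))) (comp_mem_FP (cons_mem_FP true) (comp_mem_FP sndF_mem_FP sndF_mem_FP)) (comp_mem_FP sndF_mem_FP sndF_mem_FP)

/-- Growth of the degree step: the accumulator grows by at most one symbol. [folklore] -/
theorem foldGrowth_degStep : FoldGrowth 1 degStep := by
  intro v
  rw [degStep, iteFn_of_oneBit (oneBit_andFn (oneBit_incidentChk.comp _) (oneBit_ltLenF.comp _))]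
  split_ifs <;> simp <;> omega

/-- Value of the degree step on a canonical edge code. [folklore] -/
theorem degStep_apply (v : ℕ) (L : List Bool) (e : DrawnEdge) (acc : List Bool) :
    degStep (boolPair (boolPair (encodeNat v) L) (boolPair (encodingDrawnEdge.encode e) acc)) =
      if (e.1 = v ∨ e.2.1 = v) ∧ acc.length < 4 then true :: acc else acc := by
  have hc : (andFn (incidentChk ∘ fanoutFn (fstF ∘ fstF) (fstF ∘ sndF)) (ltLenF ∘ fanoutFn (sndF ∘ sndF) fun _ => ones 4))
      (boolPair (boolPair (encodeNat v) L) (boolPair (encodingDrawnEdge.encode e) acc)) =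
      [decide ((e.1 = v ∨ e.2.1 = v) ∧ acc.length < 4)] := by
    obtain ⟨b, hb⟩ := oneBit_incidentChk (boolPair (encodeNat v) (encodingDrawnEdge.encode e))
    have hb' : b = decide (e.1 = v ∨ e.2.1 = v) := by
      have := incidentChk_eq_true v e; rw [hb] at this; cases b <;> simp_all
    rw [andFn_apply (b := b) (b' := decide (acc.length < 4)) (by simp [hb]) (by simp [ones])]
    rw [hb', Bool.decide_and]
  rw [degStep, iteFn_apply hc]
  by_cases h : (e.1 = v ∨ e.2.1 = v) ∧ acc.length < 4 <;> simp [h]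

/-- The left fold of the degree step over canonical edge codes: a saturating count of the incident
edges. [folklore] -/
theorem length_foldl_degStep (v : ℕ) (L : List Bool) : ∀ (l : List DrawnEdge) (acc : List Bool), acc.length ≤ 4 →
    ((l.map encodingDrawnEdge.encode).foldl (fun acc c => degStep (boolPair (boolPair (encodeNat v) L) (boolPair c acc)))
      acc).length = min (acc.length + l.countP fun e => decide (e.1 = v ∨ e.2.1 = v)) 4
  | [], acc, h => by simp; omega
  | e :: l, acc, h => by
    rw [List.map_cons, List.foldl_cons, degStep_apply, List.countP_cons]
    by_cases he : e.1 = v ∨ e.2.1 = v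
    · by_cases ha : acc.length < 4
      · rw [if_pos ⟨he, ha⟩, length_foldl_degStep v L l _ (by simp; omega)]; simp [he]; omega
      · rw [if_neg (fun h' => ha h'.2), length_foldl_degStep v L l _ h]; simp [he]; omega
    · rw [if_neg (fun h' => he h'.1), length_foldl_degStep v L l _ h]; simp [he]

/-- **`degChk ⟨vbin, itemsD⟩`**: the vertex `⟦vbin⟧` has at most three incident edges (the
saturating count stays below four). [cite: LiskiewiczOgiharaToda2003, §2.3 ("maximum-degree three")] -/
def degChk : List Bool → List Bool := ltLenF ∘ fanoutFn (foldFn degStep fun _ => []) fun _ => ones 4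

/-- `degChk` is one-bit and in `FP`. [folklore] -/
theorem oneBit_degChk : OneBit degChk := oneBit_ltLenF.comp _

/-- See `oneBit_degChk`. [folklore] -/
theorem degChk_mem_FP : degChk ∈ FP :=
  comp_mem_FP ltLenF_mem_FP (fanoutFn_mem_FP (foldFn_mem_FP degStep_mem_FP (const_mem_FP _) foldGrowth_degStep) (const_mem_FP _))

/-- **Truth of `degChk`.** [folklore] -/
theorem degChk_eq_true (v : ℕ) (D : List DrawnEdge) :
    degChk (boolPair (encodeNat v) (encList (D.map encodingDrawnEdge.encode))) = [true] ↔ drawnDegree D v ≤ 3 := by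
  simp only [degChk, Function.comp_apply, fanoutFn_apply, ltLenF_boolPair, foldFn_boolPair, decNil_encList]
  rw [length_foldl_degStep v _ D [] (by simp)]
  simp only [List.length_nil, zero_add, drawnDegree, List.length_replicate, List.cons.injEq, and_true, decide_eq_true_eq]
  omega

/-- The piece of the vertex loop on `⟨a, 1ᵛ⟩` (`a = ⟨Pcode, Dcode⟩`): `degChk ⟨⌜v⌝, items of D⟩`.
[folklore] -/
def degPiece : List Bool → List Bool := degChk ∘ fanoutFn (lenBinF ∘ sndF) (sndF ∘ sndF ∘ fstF)

/-- The folding operation of the vertex loop: conjunction of bits. [folklore] -/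
def andOp : List Bool → List Bool := andFn (headBitFn ∘ fstF) (headBitFn ∘ sndF)

/-- `degPiece`, `andOp` are one-bit and in `FP`. [folklore] -/
theorem degPiece_andOp_props : OneBit degPiece ∧ degPiece ∈ FP ∧ OneBit andOp ∧ andOp ∈ FP :=
  ⟨oneBit_degChk.comp _, comp_mem_FP degChk_mem_FP (fanoutFn_mem_FP (comp_mem_FP lenBinF_mem_FP sndF_mem_FP)
    (comp_mem_FP sndF_mem_FP (comp_mem_FP sndF_mem_FP fstF_mem_FP))),
    oneBit_andFn (oneBit_headBitFn.comp _) (oneBit_headBitFn.comp _),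
    andFn_mem_FP (comp_mem_FP headBitFn_mem_FP fstF_mem_FP) (comp_mem_FP headBitFn_mem_FP sndF_mem_FP)⟩

/-- The fold of bits from `[b]`. [folklore] -/
theorem foldAcc_andOp {f : List Bool → List Bool} (hf : OneBit f) (x : List Bool) :
    ∀ (k i : ℕ) (b : Bool), foldAcc andOp f x i k [b] =
      [b && decide (∀ j, i ≤ j → j < i + k → f (boolPair x (ones j)) = [true])]
  | 0, i, b => by
    cases b
    · simp
    · simp only [foldAcc_zero, Bool.true_and, add_zero]; symm
      rw [List.cons.injEq, decide_eq_true_iff]; exact ⟨fun j hj hj' => by omega, rfl⟩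
  | k + 1, i, b => by
    rw [foldAcc]
    obtain ⟨c, hc⟩ := hf (boolPair x (ones i))
    have h1 : andOp (boolPair [b] (f (boolPair x (ones i)))) = [b && c] := by
      rw [andOp, andFn_apply (b := b) (b' := c) (by simp) (by simp [hc])]
    rw [h1, foldAcc_andOp hf x k (i + 1)]
    congr 1
    rw [Bool.and_assoc]; congr 1
    rw [Bool.eq_iff_iff]
    simp only [Bool.and_eq_true, decide_eq_true_eq]
    constructor
    · rintro ⟨hc', h⟩ j hij hj
      rcases Nat.eq_or_lt_of_le hij with rfl | hlt
      · rw [hc, hc']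
      · exact h j hlt (by omega)
    · intro h
      refine ⟨?_, fun j hij hj => h j (by omega) (by omega)⟩
      have := h i le_rfl (by omega); rw [hc] at this; simpa using this

/-- The initial record of the vertex loop on `a`: `⟨a, ⟨⌜N⌝, ⟨1⁰, [1]⟩⟩⟩`. [folklore] -/
def degInit : List Bool → List Bool := fanoutFn id (fanoutFn (lenBinF ∘ fstF ∘ fstF) fun _ => boolPair [] [true])

/-- `degInit ∈ FP`. [folklore] -/
theorem degInit_mem_FP : degInit ∈ FP :=
  fanoutFn_mem_FP (PolyTimeComputable.id _) (fanoutFn_mem_FP (comp_mem_FP lenBinF_mem_FP (comp_mem_FP fstF_mem_FP fstF_mem_FP))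
    (const_mem_FP _))

/-- **`degAllChk a`**: every vertex `v < N` passes `degChk` (an indexed fold of `N` rounds).
[cite: LiskiewiczOgiharaToda2003, §2.3 ("maximum-degree three")] -/
def degAllChk : List Bool → List Bool := headBitFn ∘ sndPow 2 ∘ foldLoop andOp degPiece Polynomial.X ∘ degInit

/-- `degAllChk` is one-bit and in `FP`. [folklore] -/
theorem oneBit_degAllChk : OneBit degAllChk := oneBit_headBitFn.comp _

/-- See `oneBit_degAllChk`. [folklore] -/
theorem degAllChk_mem_FP : degAllChk ∈ FP := by
  obtain ⟨h1, h2, h3, h4⟩ := degPiece_andOp_props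
  exact comp_mem_FP headBitFn_mem_FP (comp_mem_FP (sndPow_mem_FP 2) (comp_mem_FP
    (foldLoop_mem_FP (d := 1) (C := 1) h4 (fun w => by rw [h3.length_eq]; omega) h2 (fun w => by rw [h1.length_eq]; omega) _)
    degInit_mem_FP))

/-- **Truth of `degAllChk`.** [folklore] -/
theorem degAllChk_eq_true (P : List GridPoint) (D : List DrawnEdge) :
    degAllChk (boolPair (encodingGridPoint.listBool.encode P) (encodingDrawnEdge.listBool.encode D)) = [true] ↔
      ∀ v < P.length, drawnDegree D v ≤ 3 := by
  obtain ⟨h1, -, -, -⟩ := degPiece_andOp_props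
  have hinit : degInit (boolPair (encodingGridPoint.listBool.encode P) (encodingDrawnEdge.listBool.encode D)) =
      boolPair (boolPair (encodingGridPoint.listBool.encode P) (encodingDrawnEdge.listBool.encode D))
        (boolPair (encodeNat P.length) (boolPair (ones 0) [true])) := by
    simp [degInit, encode_pointList_eq, Literature.Computability.MetaComplexity.length_unaryEncodeNat]
  have hN : P.length ≤ Polynomial.X.eval (boolPair (encodingGridPoint.listBool.encode P)
      (encodingDrawnEdge.listBool.encode D)).length := by
    simp only [Polynomial.eval_X, length_boolPair, encode_pointList_eq, Literature.Computability.MetaComplexity.length_unaryEncodeNat]; omega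
  rw [degAllChk, Function.comp_apply, Function.comp_apply, Function.comp_apply, hinit, foldLoop_apply _ _ hN,
    foldAcc_andOp h1]
  simp only [sndPow, Function.comp_apply, sndF_boolPair, headBitFn_apply, List.headD_cons, Bool.true_and, zero_add,
    List.cons.injEq, and_true, decide_eq_true_eq, Nat.zero_le, forall_const]
  refine forall₂_congr fun v _ => ?_
  rw [degPiece, Function.comp_apply, fanoutFn_apply, Function.comp_apply, sndF_boolPair, lenBinF_apply, List.length_replicate]
  simp only [Function.comp_apply, fstF_boolPair, sndF_boolPair, encode_drawnEdgeList_eq, degChk_eq_true]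

end Degrees

/-! ### The drawing checker -/

section DrawingChk

/-- (C1) the vertex images are distinct. [folklore] -/
def c1F : List Bool → List Bool := nodupFn ∘ fanoutFn (fun _ => []) (sndF ∘ fstF)
/-- (C2) every edge is correctly drawn. [folklore] -/
def c2F : List Bool → List Bool := allFn edgeChk ∘ fanoutFn fstF (sndF ∘ sndF)
/-- (C3) no repeated edge and no two edges with the same ends. [folklore] -/
def c3F : List Bool → List Bool :=
  andFn (nodupFn ∘ fanoutFn (fun _ => []) (sndF ∘ sndF))
    (allPairsFn (endsPairChk ∘ fanoutFn (sndF ∘ fstF) sndF) ∘ fanoutFn (fun _ => []) (sndF ∘ sndF))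
/-- (C4) two edges meet only in vertex images. [folklore] -/
def c4F : List Bool → List Bool := allPairsFn cfPairChk ∘ fanoutFn (sndF ∘ fstF) (sndF ∘ sndF)

/-- **The drawing checker** on `⟨code P, code D⟩`: `IsGridDrawing P D`.
[cite: LiskiewiczOgiharaToda2003, §4 (proof of Theorem 7: embeddings "with no vertex congestion")] -/
def drawingChk : List Bool → List Bool := andFn c1F (andFn c2F (andFn c3F (andFn c4F degAllChk)))

/-- The parts are one-bit. [folklore] -/
theorem oneBit_drawingChk_parts : OneBit c1F ∧ OneBit c2F ∧ OneBit c3F ∧ OneBit c4F :=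
  ⟨oneBit_nodupFn.comp _, (oneBit_allFn oneBit_edgeChk).comp _,
    oneBit_andFn (oneBit_nodupFn.comp _) ((oneBit_allPairsFn _ (oneBit_endsPairChk.comp _)).comp _),
    (oneBit_allPairsFn _ oneBit_cfPairChk).comp _⟩

/-- `drawingChk` is one-bit. [folklore] -/
theorem oneBit_drawingChk : OneBit drawingChk := by
  obtain ⟨h1, h2, h3, h4⟩ := oneBit_drawingChk_parts
  exact oneBit_andFn h1 (oneBit_andFn h2 (oneBit_andFn h3 (oneBit_andFn h4 oneBit_degAllChk)))

/-- **`drawingChk ∈ FP`.** [folklore] -/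
theorem drawingChk_mem_FP : drawingChk ∈ FP :=
  andFn_mem_FP (comp_mem_FP nodupFn_mem_FP (fanoutFn_mem_FP (const_mem_FP _) (comp_mem_FP sndF_mem_FP fstF_mem_FP)))
  (andFn_mem_FP (comp_mem_FP (allFn_mem_FP edgeChk_mem_FP oneBit_edgeChk) (fanoutFn_mem_FP fstF_mem_FP
    (comp_mem_FP sndF_mem_FP sndF_mem_FP)))
  (andFn_mem_FP (andFn_mem_FP (comp_mem_FP nodupFn_mem_FP (fanoutFn_mem_FP (const_mem_FP _) (comp_mem_FP sndF_mem_FP sndF_mem_FP)))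
    (comp_mem_FP (allPairsFn_mem_FP (comp_mem_FP endsPairChk_mem_FP (fanoutFn_mem_FP (comp_mem_FP sndF_mem_FP fstF_mem_FP) sndF_mem_FP))
      (oneBit_endsPairChk.comp _)) (fanoutFn_mem_FP (const_mem_FP _) (comp_mem_FP sndF_mem_FP sndF_mem_FP))))
  (andFn_mem_FP (comp_mem_FP (allPairsFn_mem_FP cfPairChk_mem_FP oneBit_cfPairChk) (fanoutFn_mem_FP
    (comp_mem_FP sndF_mem_FP fstF_mem_FP) (comp_mem_FP sndF_mem_FP sndF_mem_FP))) degAllChk_mem_FP)))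

variable (P : List GridPoint) (D : List DrawnEdge)

/-- The canonical argument of the drawing checker. [folklore] -/
def drawingArg : List Bool := boolPair (encodingGridPoint.listBool.encode P) (encodingDrawnEdge.listBool.encode D)

/-- (C1) is `P.Nodup`. [folklore] -/
theorem c1_drawingArg : c1F (drawingArg P D) = [true] ↔ P.Nodup := by
  simp only [c1F, drawingArg, Function.comp_apply, fanoutFn_apply, fstF_boolPair, sndF_boolPair, encode_pointList_eq,
    nodupFn_encList_eq_true]
  exact List.nodup_map_iff encodingGridPoint.encode_injective

/-- (C2) is "every edge is correctly drawn". [folklore] -/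
theorem c2_drawingArg : c2F (drawingArg P D) = [true] ↔ ∀ e ∈ D, IsDrawnEdgeOf P e := by
  simp only [c2F, drawingArg, Function.comp_apply, fanoutFn_apply, fstF_boolPair, sndF_boolPair, encode_drawnEdgeList_eq,
    allFn_boolPair_eq_true oneBit_edgeChk, decNil_encList, List.forall_mem_map]
  exact forall₂_congr fun e _ => edgeChk_edgeArg_eq_true P e

/-- (C3) is the pairwise ends clause. [folklore] -/
theorem c3_drawingArg : c3F (drawingArg P D) = [true] ↔ D.Pairwise fun e e' => ¬ SameEnds e e' := by
  rw [c3F, andFn_eq_true_iff (oneBit_nodupFn.comp _) ((oneBit_allPairsFn _ (oneBit_endsPairChk.comp _)).comp _),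
    pairwise_iff_nodup_and (fun e h => h (Or.inl ⟨rfl, rfl⟩)) (fun e e' h h' => h (by unfold SameEnds at *; omega))]
  simp only [drawingArg, Function.comp_apply, fanoutFn_apply, sndF_boolPair, encode_drawnEdgeList_eq, nodupFn_encList_eq_true,
    List.nodup_map_iff encodingDrawnEdge.encode_injective, allPairsFn_eq_true (oneBit_endsPairChk.comp _), List.forall_mem_map,
    fstF_boolPair, endsPairChk_eq_true]

/-- (C4), for a list without repetitions, is the pairwise congestion clause. [folklore] -/
theorem c4_drawingArg (hnd : D.Nodup) :
    c4F (drawingArg P D) = [true] ↔ D.Pairwise fun e e' => ∀ p ∈ e.2.2, p ∈ e'.2.2 → p ∈ P := by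
  simp only [c4F, drawingArg, Function.comp_apply, fanoutFn_apply, fstF_boolPair, sndF_boolPair, encode_pointList_eq,
    encode_drawnEdgeList_eq, allPairsFn_eq_true oneBit_cfPairChk, List.forall_mem_map, cfPairChk_eq_true]
  constructor
  · intro h
    exact hnd.imp_of_mem fun ha hb hab => (h _ ha _ hb).resolve_left hab
  · intro h a ha b hb
    by_cases hab : a = b
    · exact Or.inl hab
    · rcases pairwise_mem_mem h ha hb hab with h' | h'
      · exact Or.inr h'
      · exact Or.inr fun p hp hp' => h' p hp' hp

/-- **Truth of the drawing checker.** [cite: LiskiewiczOgiharaToda2003, §4 (proof of Theorem 7)] -/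
theorem drawingChk_drawingArg_eq_true : drawingChk (drawingArg P D) = [true] ↔ IsGridDrawing P D := by
  obtain ⟨h1, h2, h3, h4⟩ := oneBit_drawingChk_parts
  rw [drawingChk, andFn_eq_true_iff h1 (oneBit_andFn h2 (oneBit_andFn h3 (oneBit_andFn h4 oneBit_degAllChk))),
    andFn_eq_true_iff h2 (oneBit_andFn h3 (oneBit_andFn h4 oneBit_degAllChk)), andFn_eq_true_iff h3 (oneBit_andFn h4 oneBit_degAllChk),
    andFn_eq_true_iff h4 oneBit_degAllChk, c1_drawingArg, c2_drawingArg, c3_drawingArg]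
  rw [show degAllChk (drawingArg P D) = [true] ↔ ∀ v < P.length, drawnDegree D v ≤ 3 from degAllChk_eq_true P D]
  unfold IsGridDrawing
  constructor
  · rintro ⟨hP, hE, hS, hC, hdeg⟩
    have hnd : D.Nodup := List.Pairwise.imp (S := fun a b => a ≠ b) (fun {a b} hab heq => by
      subst heq; exact hab (Or.inl ⟨rfl, rfl⟩)) hS
    exact ⟨hP, hE, hS, (c4_drawingArg P D hnd).1 hC, hdeg⟩
  · rintro ⟨hP, hE, hS, hC, hdeg⟩
    have hnd : D.Nodup := List.Pairwise.imp (S := fun a b => a ≠ b) (fun {a b} hab heq => by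
      subst heq; exact hab (Or.inl ⟨rfl, rfl⟩)) hS
    exact ⟨hP, hE, hS, (c4_drawingArg P D hnd).2 hC, hdeg⟩

end DrawingChk

end Literature.Barriers.CriticalPhenomena.GridSAW
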